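import Mathlib
import Summits.ResolutionOfSingularities.ResolutionOfSingularities.Theorems.WildQuotientsWildQuotientResolutionTerminalBlowupSpec
import Summits.ResolutionOfSingularities.ResolutionOfSingularities.Theorems.WildQuotientsWildQuotientResolutionTwoBlocksAssembly
import Summits.ResolutionOfSingularities.ResolutionOfSingularities.Theorems.WildQuotientsWildQuotientResolutionTwoBlocksBlowup
import Summits.ResolutionOfSingularities.ResolutionOfSingularities.Theorems.WildQuotientsWildQuotientResolutionTwoBlocksCentreStable
import Summits.ResolutionOfSingularities.ResolutionOfSingularities.Theorems.WildQuotientsWildQuotientResolutionTwoBlocksAugIdeal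
import Summits.ResolutionOfSingularities.ResolutionOfSingularities.Theorems.WildQuotientsWildQuotientResolutionStubStableAffineCoverBlowup
import HarnessLib

/-!
# `𝔸⁴/(J₂ ⊕ J₂)` has a resolution of singularities in every characteristic (programme T of chain w45c: terminal model and target)

(crux stmt-ResolutionOfSingularities-15640 `WildQuotients.WildQuotientResolution`, line `Sketch`,
programme «INSTANTIATE T1»; [OURS · L1 W4.5c] — NOT a statement of any manuscript.)

* `twoBlocks_terminalModel` (S4-scheme, the CONTRACT of `W45cPlanSignaturesV3.lean` with the
  planning abbreviations unfolded): for `σ = J₂ ⊕ J₂` on `k[x₀,…,x₃]` and ANY action `ρ` of `⟨σ⟩`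
  on `𝔸⁴` with `ρ g = Spec (g⁻¹)`, the blow-up `V = Bl_{(x₀,x₂)} 𝔸⁴` with the lifted action
  (`IsBlowup.liftAction`, centre stable by `TwoBlocks.idealSheaf_centre_comap`) is a
  Király–Lütkebohmert terminal model: regular, integral, proper, birational
  (`TwoBlocks.stub_twoBlocks_blowup_regular`), equivariant (`liftAction_hom_comp`), with a
  `⟨σ⟩`-stable affine cover (`StableAffineCoverBlowup.stub_stableAffineCoverBlowup` over the affine
  quotient map), and principal stalk augmentation ideals at fixed points — stub-2's equivariant
  blow-up lemma `TerminalBlowup.isPrincipal_stalkAug_liftAction_spec` fed with the ring facts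
  `TwoBlocks.smul_sub_mem_centre` (`g • b - b ∈ (x₀,x₂)`), `TwoBlocks.X_zero_mem_augIdeal` /
  `X_two_mem_augIdeal` (`x₀, x₂ ∈ ⟨g • b - b⟩` for `g ≠ 1`), the generators being fixed.
* `twoJordanBlocksFourfold_hasResolution` — TARGET T: the wild quotient fourfold `𝔸⁴/(J₂ ⊕ J₂)`
  has a resolution of singularities in EVERY characteristic `p`
  (`TwoBlocks.twoJordanBlocksFourfold_hasResolution_of_model` ∘ `twoBlocks_terminalModel`): an
  instance of `CyclicQuotientFourfolds` (stmt-17941) at every prime, including `p = 2, 3`.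
-/

-- single-problem summit: the doubled namespace component `ResolutionOfSingularities` is forced
set_option linter.dupNamespace false

noncomputable section

open CategoryTheory AlgebraicGeometry TopologicalSpace MvPolynomial
open scoped Pointwise
open Literature.AlgebraicGeometry.Resolution

namespace Summit.ResolutionOfSingularities.ResolutionOfSingularities.Theorems.WildQuotientResolution.TwoBlocks

/-- **S4-scheme: `Bl_{(x₀,x₂)} 𝔸⁴` with the lifted action is a Király–Lütkebohmert terminal model
of `J₂ ⊕ J₂`**, for ANY action `ρ` of `⟨σ⟩` on `𝔸⁴` with `ρ g = Spec (g⁻¹)` (the seven model-side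
hypotheses of `CyclicTransfer.cyclicDivisorialTransfer_of_card`, in that order).
[cite: KiralyLutkebohmert2013, Thm 2] [cite: GortzWedhorn2020, Prop. 13.91] -/
theorem twoBlocks_terminalModel (p : ℕ) (hp : p.Prime) (k : Type) [Field k] [CharP k p]
    (σ : MvPolynomial (Fin 4) k ≃ₐ[k] MvPolynomial (Fin 4) k)
    (h0 : σ (X 0) = X 0) (h1 : σ (X 1) = X 1 + X 0)
    (h2 : σ (X 2) = X 2) (h3 : σ (X 3) = X 3 + X 2)
    (ρ : ↥(Subgroup.zpowers σ) →* Aut (Spec (CommRingCat.of (MvPolynomial (Fin 4) k))))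
    (hρ : ∀ g : ↥(Subgroup.zpowers σ), (ρ g).hom = Spec.map (CommRingCat.ofHom
      ((MulSemiringAction.toRingEquiv (↥(Subgroup.zpowers σ)) (MvPolynomial (Fin 4) k) g⁻¹ :
        MvPolynomial (Fin 4) k ≃+* MvPolynomial (Fin 4) k) :
          MvPolynomial (Fin 4) k →+* MvPolynomial (Fin 4) k))) :
    ∃ (V : Scheme.{0}) (π : V ⟶ Spec (CommRingCat.of (MvPolynomial (Fin 4) k)))
      (ρV : ↥(Subgroup.zpowers σ) →* Aut V), IsProper π ∧ IsBirational π ∧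
      IsIntegral V ∧ Scheme.IsRegular V ∧
      (∀ g : ↥(Subgroup.zpowers σ), (ρV g).hom ≫ π = π ≫ (ρ g).hom) ∧
      (∀ v : V, ∃ W : V.Opens, IsAffineOpen W ∧ v ∈ W ∧
        ∀ g : ↥(Subgroup.zpowers σ), (ρV g).hom ⁻¹ᵁ W = W) ∧
      ∀ (g : ↥(Subgroup.zpowers σ)) (v : V) (hv : (ρV g).hom.base v = v),
        (Ideal.span (Set.range fun s : V.presheaf.stalk v =>
          (V.presheaf.stalkSpecializes (specializes_of_eq hv) ≫ (ρV g).hom.stalkMap v).hom s -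
            s)).IsPrincipal := by
  classical
  let S : Type := MvPolynomial (Fin 4) k
  let G : Type := ↥(Subgroup.zpowers σ)
  let I : Ideal S := Ideal.span {X 0, X 2}
  obtain ⟨hσp, -, hcard⟩ := stub_twoBlocks_order p hp k σ h0 h1 h2 h3
  haveI : Fact p.Prime := ⟨hp⟩
  haveI : Finite G := Nat.finite_of_card_ne_zero (hcard ▸ hp.ne_zero)
  -- the blow-up and the lifted action
  have hπ : IsBlowup (affineBlowup.π I) (affineBlowup.idealSheaf I) := affineBlowup.isBlowup I
  have hJ : ∀ g : G, (affineBlowup.idealSheaf I).comap (ρ g).hom = affineBlowup.idealSheaf I :=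
    idealSheaf_centre_comap k σ h0 h2 ρ hρ
  obtain ⟨hreg, hint, hprop, hbir⟩ := stub_twoBlocks_blowup_regular k
  refine ⟨affineBlowup I, affineBlowup.π I, hπ.liftAction ρ hJ, hprop, hbir, hint, hreg,
    hπ.liftAction_hom_comp ρ hJ, ?_, ?_⟩
  · -- a `G`-stable affine cover: Mumford's lemma over the affine quotient map `𝔸⁴ → 𝔸⁴/G`
    intro v
    let A : Subalgebra k S := FixedPoints.subalgebra k S G
    let q : Spec (.of S) ⟶ Spec (.of A) := Spec.map (CommRingCat.ofHom (algebraMap A S))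
    have hρq : ∀ g : G, (ρ g).hom ≫ q = q := AffineQuotient.specAction_comp k ρ hρ
    exact StableAffineCoverBlowup.stub_stableAffineCoverBlowup q ρ hρq hπ (hπ.liftAction ρ hJ)
      (hπ.liftAction_hom_comp ρ hJ) v
  · -- principal stalk augmentation ideals at fixed points
    intro g v hv
    by_cases hg : g = 1
    · -- trivial element: the augmentation ideal is zero
      subst hg
      have hzero : (Set.range fun s : (affineBlowup I).presheaf.stalk v =>
          ((affineBlowup I).presheaf.stalkSpecializes (specializes_of_eq hv) ≫
            ((hπ.liftAction ρ hJ) 1).hom.stalkMap v).hom s - s) = {0} := by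
        have h1 : ((hπ.liftAction ρ hJ) 1).hom = 𝟙 _ := by rw [map_one]; rfl
        ext t
        simp only [Set.mem_range, Set.mem_singleton_iff]
        constructor
        · rintro ⟨s, rfl⟩
          have : ((affineBlowup I).presheaf.stalkSpecializes (specializes_of_eq hv) ≫
              ((hπ.liftAction ρ hJ) 1).hom.stalkMap v).hom s = s := by
            have e : (affineBlowup I).presheaf.stalkSpecializes (specializes_of_eq hv) ≫
                ((hπ.liftAction ρ hJ) 1).hom.stalkMap v = 𝟙 _ := by
              rw [Scheme.Hom.stalkMap_congr_hom _ _ h1, Scheme.Hom.stalkMap_id]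
              simp
            rw [e]; rfl
          rw [this, sub_self]
        · rintro rfl
          exact ⟨0, by simp⟩
      rw [hzero, Ideal.span_singleton_zero]
      exact ⟨0, by simp⟩
    · have hX0 : (X 0 : S) ∈ FixedPoints.subalgebra k S G :=
        (TameTransfer.mem_fixedPoints_zpowers_iff_apply_eq σ (X 0)).mpr h0
      have hX2 : (X 2 : S) ∈ FixedPoints.subalgebra k S G :=
        (TameTransfer.mem_fixedPoints_zpowers_iff_apply_eq σ (X 2)).mpr h2
      refine TerminalBlowup.isPrincipal_stalkAug_liftAction_spec ρ hρ I hπ hJ g ![X 0, X 2]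
        (span_pair_eq k).1 ?_ (fun b => smul_sub_mem_centre k σ h0 h1 h2 h3 g b) ?_ v hv
      · intro j
        fin_cases j
        · exact hX0 g
        · exact hX2 g
      · intro j
        fin_cases j
        · exact X_zero_mem_augIdeal p hp k σ h0 h1 h2 h3 g hg
        · exact X_two_mem_augIdeal p hp k σ h0 h1 h2 h3 g hg

/-- **TARGET T: the wild quotient fourfold `𝔸⁴/(J₂ ⊕ J₂)` has a resolution of singularities in
every characteristic `p`** (programme «INSTANTIATE T1» of chain w45c; an instance of
`CyclicQuotientFourfolds`, stmt-ResolutionOfSingularities-17941, at every prime — including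
`p = 2, 3` outside the range of `JordanBlockFourfold`): `twoJordanBlocksFourfold_hasResolution_of_model`
(quotient data + transfer) applied to `twoBlocks_terminalModel` (one equivariant blow-up of the
fixed plane). [cite: KiralyLutkebohmert2013, Thm 2] [cite: SGA1, Exp. V, §1–2] -/
theorem twoJordanBlocksFourfold_hasResolution (p : ℕ) (hp : p.Prime) (k : Type) [Field k]
    [CharP k p] (σ : MvPolynomial (Fin 4) k ≃ₐ[k] MvPolynomial (Fin 4) k)
    (h0 : σ (X 0) = X 0) (h1 : σ (X 1) = X 1 + X 0)
    (h2 : σ (X 2) = X 2) (h3 : σ (X 3) = X 3 + X 2) :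
    Scheme.HasResolution
      (Spec (.of (FixedPoints.subalgebra k (MvPolynomial (Fin 4) k) (Subgroup.zpowers σ)))) :=
  twoJordanBlocksFourfold_hasResolution_of_model p hp k σ h0 h1 h2 h3
    fun ρ hρ => twoBlocks_terminalModel p hp k σ h0 h1 h2 h3 ρ hρ

end Summit.ResolutionOfSingularities.ResolutionOfSingularities.Theorems.WildQuotientResolution.TwoBlocks

end
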